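/- Copyright: the b2b-balaban cell (near-miss cell 7), T⁴-continuum fan-out; row NE7b ROUND-2 swarm, seat
t4-ne7b-formalise-leaf-06 (gen 3) (road W-RP-VAR, row W4 file 2 «THE EVENT READING» of
`t4/b2b-balaban-t4-ne7b-p1/LEAVES-NE7b.md`, owner ruling R-OWNER-23-2; INTENT journal l.13372; memo
`t4/b2b-balaban-t4-ne7-p2/g27/IDEAS-NE7-g27.md` §1 (EXT)(LOC)(R-sym)(DRESS)).  Released under the licence of the
surrounding project. -/
import Summits.QuantumFields.BalabanUV.T4Continuum.Support.HistoryChessboardAssembly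
import Summits.QuantumFields.BalabanUV.T4Continuum.Support.HistoryChessboardRP

/-!
# Road W-RP-VAR, row W4 file 2: THE EVENT READING — W4's ψ-currency displays read from ONE probability measure

Summits-side support leaf of the T⁴-continuum cell (rung (B)+1 on a FINITE torus only; NOT infinite volume, NOT the
mass gap, NOT the Clay statement; NOT a proof of the spine estimate NE7b).  Row NE7b, road **W-RP-VAR** (owner's
ruling R-OWNER-23-2: a LIVE SECONDARY road beside the COUNT road of record), row **W4**, file 2 (a twin END over row
W5; «welcome, nobody obliged», owner l.13286).  [folklore] measure-theoretic bookkeeping (Mathlib) over the cell's OWN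
records: it CONSUMES, BY NAME, row W4 file 1 (`HistoryChessboardAssembly`: `ChessboardReading` ⇒ `RelWeightBound` ⇒
`HybridNE7`), row W5 (`HistoryChessboardRP.chessboardFields_of_isReflectionPositiveBdd`: the tree's bounded reflection
positivity of a measure ⇒ the chessboard fields), row W1 (`HistoryChessboardDressing.dressing_of_linear`) and the tree's
definition `LatticeRP.IsReflectionPositiveBdd` (file `LatticeRPSignRule`).  Nothing is quoted from Bałaban's papers,
nothing printed is asserted, no citation tag of the series, no `Prop`-valued FACT minted (trigger c1) and no `def`: the
one `structure … : Prop` below (`EventReading`) is a HYPOTHESIS SHAPE consumed only as a binder (definition lane).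

WHY.  File 1 displays the road's binders in ψ-CURRENCY.  All of them except (VAR), (U1), (G2) are, in the memo's words,
statements about ONE positive measure per run and cutoff (the normalised extended state): «terms are events» (EXT), «bad
events lie inside cell events» (LOC), «cell events are reflection-related» (R-sym), «the state is reflection positive
across block hyperplanes» (RP-ext), «the source dresses each term two-sidedly» (DRESS).  This file types those sentences
in Mathlib's measure theory and DERIVES file 1's `ChessboardReading` and W1's dressing inequalities from them.

WHAT.  §1 `EventReading …` — ONE run from the threshold `K₀` on: per cutoff a PROBABILITY measure `μ K` on a carrier
`Ω` (READING, docstring only: the normalised extended state of the CENTRED prescription), the undressed partition function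
`Z K`, term events `ev K τ`, a bounded source observable `obs K`, cell events `E K l c`, per block hyperplane a reflection
`θ K i k` and a positive-half σ-algebra `mP K i k`, the rate `r K`; its fields are the memo's sentences (see the
structure's docstring).  §2 the derivations `weight_zero_eq`, `dressing` (W1's two inequalities, `m = ob·l₀`),
`sum_bad_le_cells`∕`cover` (file 1's `cover`), `measureReal_biInter_eq_integral_prod_indicator`, and
**`EventReading.chessboardReading`** (file 1's `ChessboardReading`, the chessboard fields by W5 at `b c := 𝟙_{E K l c}`).
§3 the END **`hybridNE7_of_events`** = file 1's `hybridNE7_of_chessboard` with `HA`, `HB`, `hAd`, `hBd` DISCHARGED.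
§4 sanity: the event reading is INHABITED (one-point carrier, Dirac state, identity reflections).

HONEST SCOPE (R-OWNER-23-2 (iii), verbatim for this §W row): W-RP-VAR is a producer of NE7b's socket for the
CENTRED-AVERAGING VARIANT of the construction, NOT for Bałaban's printed corner prescription (for which reflection
positivity of the extended measure FAILS, (11c)); the road discharges NE7b only modulo (VAR) + (U1) + (G2) + (EXT)∕(RP-ext)
DISPLAYED — here: the fields of `EventReading`, now sentences about one measure —; (VAR) stays a docstring sentence (which
prescription the state comes from is not a kernel object); the count 0∕9 is unchanged; nothing of H3 ∕ (B) ∕ BetaPertH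
is discharged; no exit ∕ socket ∕ `HistoryConstants` file is touched (c3).  NE7b NOT proved; spine 0∕9.  HONEST
DEPENDENCY (cell): continuum YM on T⁴ ⇐ BetaPertH ∧ nine spine estimates (0/9 proved); BetaPertH ⇐ (D1) ∧ (D4) ∧
CAP+tail; G-an2-4 gates asym, D1 and NE2/3/4.  This file changes none of it.
-/

open Finset MeasureTheory
open Literature.MathematicalPhysics.QuantumFieldTheory.Balaban1983to89
open Literature.MathematicalPhysics.QuantumFieldTheory.Balaban1983to89.T4WeightBudget
open Literature.MathematicalPhysics.QuantumFieldTheory.Balaban1983to89.T4IndicatorShell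
open Literature.MathematicalPhysics.QuantumFieldTheory.Balaban1983to89.T4MatchingAssembly
open Literature.MathematicalPhysics.QuantumFieldTheory.Balaban1983to89.T4MatchingClosure
open Literature.Barriers.CriticalPhenomena.NonGibbs Literature.Probability.LatticeModels
open Literature.MathematicalPhysics.QuantumFieldTheory.LatticeRP (IsReflectionPositiveBdd)
open Summit.QuantumFields.BalabanUV.T4Continuum.HistoryChessboardAssembly

namespace Summit.QuantumFields.BalabanUV.T4Continuum.HistoryChessboardEvents

noncomputable section

/-! ## §1 The event reading of ONE run: W4's displays as sentences about one probability measure per cutoff -/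
section Reading

variable {Ω ι Λ : Type*} [MeasurableSpace Ω]

/-- **THE EVENT READING OF ONE RUN** (road W-RP-VAR, row W4 file 2).  Carrier: a measurable space `Ω` and, per cutoff
`K ≥ K₀`, a PROBABILITY measure `μ K` (READING, not instantiated: the normalised extended state `μ_ext,K ∕ Z_K` of the run
at cutoff `K` for the CENTRED averaging prescription — (VAR) is this sentence and nothing else), the undressed partition
function `Z K`, the term events `ev K τ`, a source observable `obs K` bounded by `ob`, the cell events `E K l c` of the
patterns `l ∈ P` (the shifted tilings) on the block torus `BlockIdx d N`, per block hyperplane `(i, k)` a reflection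
`θ K i k : Ω → Ω` and a positive-half σ-algebra `mP K i k`, the per-cell rate `r K`.  Clauses, for `K ≥ K₀`:
* `prob`, `Z_pos`, `bad_subset`, `ev_meas`, `E_meas`, `obs_meas`, `obs_bdd`, `ob_nonneg` — bookkeeping;
* `repr` — (EXT)+(DRESS): the dressed weight of term `τ` IS the source-dressed mass of its event,
  `A K t τ = Z K · ∫_{ev K τ} e^{t·obs K} dμ_K` (READ: the history expansion is a partition of unity of the extended state
  subordinate to the characters, B15 (1.28)∕p.183 reading; the loop source enters as `e^{t·O}`);
* `ev_cover` — the term events exhaust the state (READ: the expansion is a partition of unity);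
* `bad_disj`, `bad_sub` — (EXT)∘(LOC): bad events are pairwise disjoint and each lies inside a single-cell event of some
  shifted tiling (READ: a pending chain lies in the interior of a cell of at least one of the `2^d` shifted tilings);
* `mP_le`, `θ_meas`, `θ_pres`, `θ_invol`, `rp` — (RP-ext)+(VAR): across every block hyperplane the state is reflection
  positive in the tree's bounded form `LatticeRP.IsReflectionPositiveBdd` for a measurable measure-preserving involution
  (NEW-UNPRINTED for the extended state; FAILS for the printed corner prescription; row W3 documents the derivation);
* `loc` — (LOC): the cell events of the positive half are positive-half measurable;
* `sym` — (R-sym): the cell events are reflection-related, `θ ⁻¹' E_c = E_{θc}`;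
* `univ_le`, `r_nonneg` — (U1)+(G2) in ratio currency: the universally forced pattern has probability `≤ (r K)^(N^d)`.
A hypothesis SHAPE; NOTHING of Bałaban's is asserted; no citation tag (nothing printed is stated). [folklore] -/
structure EventReading (d N : ℕ) [NeZero N] (P : Finset Λ) (T : ℕ → Finset ι) (A : ℕ → ℝ → ι → ℝ)
    (Bad : ℕ → Finset ι) (μ : ℕ → Measure Ω) (Z : ℕ → ℝ) (ev : ℕ → ι → Set Ω) (obs : ℕ → Ω → ℝ) (ob : ℝ)
    (E : ℕ → Λ → BlockIdx d N → Set Ω) (θ : ℕ → Fin d → ZMod N → Ω → Ω)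
    (mP : ℕ → Fin d → ZMod N → MeasurableSpace Ω) (r : ℕ → ℝ) (K₀ : ℕ) : Prop where
  /-- the state at every cutoff is a probability measure (the NORMALISED extended state) -/
  prob : ∀ K, K₀ ≤ K → IsProbabilityMeasure (μ K)
  /-- the undressed partition function is positive -/
  Z_pos : ∀ K, K₀ ≤ K → 0 < Z K
  /-- the bad class consists of terms -/
  bad_subset : ∀ K, K₀ ≤ K → Bad K ⊆ T K
  /-- term events are measurable -/
  ev_meas : ∀ K, K₀ ≤ K → ∀ τ ∈ T K, MeasurableSet (ev K τ)
  /-- cell events are measurable -/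
  E_meas : ∀ K, K₀ ≤ K → ∀ l ∈ P, ∀ c, MeasurableSet (E K l c)
  /-- the source observable is measurable … -/
  obs_meas : ∀ K, K₀ ≤ K → Measurable (obs K)
  /-- … and bounded by `ob` (read: `ob = ‖obs‖_∞` of the loop observable) -/
  obs_bdd : ∀ K, K₀ ≤ K → ∀ ω, |obs K ω| ≤ ob
  /-- the bound is nonnegative (automatic on a nonempty carrier; recorded for the empty one) -/
  ob_nonneg : 0 ≤ ob
  /-- (EXT)+(DRESS): the dressed weight of a term is the source-dressed mass of its event -/
  repr : ∀ K, K₀ ≤ K → ∀ (t : ℝ), ∀ τ ∈ T K,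
    A K t τ = Z K * ∫ ω in ev K τ, Real.exp (t * obs K ω) ∂(μ K)
  /-- the term events exhaust the state (partition of unity) -/
  ev_cover : ∀ K, K₀ ≤ K → Set.univ ⊆ ⋃ τ ∈ T K, ev K τ
  /-- (EXT): bad events are pairwise disjoint -/
  bad_disj : ∀ K, K₀ ≤ K → (↑(Bad K) : Set ι).PairwiseDisjoint (ev K)
  /-- (EXT)∘(LOC): every bad event lies inside a single-cell event of some pattern -/
  bad_sub : ∀ K, K₀ ≤ K → ∀ τ ∈ Bad K, ev K τ ⊆ ⋃ l ∈ P, ⋃ c : BlockIdx d N, E K l c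
  /-- the positive-half σ-algebras are sub-σ-algebras of the carrier's -/
  mP_le : ∀ K, K₀ ≤ K → ∀ (i : Fin d) (k : ZMod N), mP K i k ≤ ‹MeasurableSpace Ω›
  /-- the reflections are measurable … -/
  θ_meas : ∀ K, K₀ ≤ K → ∀ (i : Fin d) (k : ZMod N), Measurable (θ K i k)
  /-- … preserve the state … -/
  θ_pres : ∀ K, K₀ ≤ K → ∀ (i : Fin d) (k : ZMod N), MeasurePreserving (θ K i k) (μ K) (μ K)
  /-- … and are involutions -/
  θ_invol : ∀ K, K₀ ≤ K → ∀ (i : Fin d) (k : ZMod N), θ K i k ∘ θ K i k = id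
  /-- (RP-ext)+(VAR): the state is reflection positive across every block hyperplane (tree's bounded form) -/
  rp : ∀ K, K₀ ≤ K → ∀ (i : Fin d) (k : ZMod N), IsReflectionPositiveBdd (μ K) (mP K i k) (θ K i k)
  /-- (LOC): the cell events of the positive half are positive-half measurable -/
  loc : ∀ K, K₀ ≤ K → ∀ l ∈ P, ∀ (i : Fin d) (k : ZMod N), ∀ c ∈ halfPlus N i k,
    MeasurableSet[mP K i k] (E K l c)
  /-- (R-sym): the cell events are reflection-related -/
  sym : ∀ K, K₀ ≤ K → ∀ l ∈ P, ∀ (i : Fin d) (k : ZMod N) (c : BlockIdx d N),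
    θ K i k ⁻¹' E K l c = E K l (cellReflect i k c)
  /-- (U1)+(G2), ratio currency: the universally forced pattern has probability `≤ (r K)^(N^d)` -/
  univ_le : ∀ K, K₀ ≤ K → ∀ l ∈ P,
    (μ K).real (⋂ c ∈ (Finset.univ : Finset (BlockIdx d N)), E K l c) ≤ r K ^ (N ^ d)
  /-- the per-cell rate is nonnegative -/
  r_nonneg : ∀ K, K₀ ≤ K → 0 ≤ r K

end Reading

/-! ## §2 The derivations: undressed weights, dressing, the cover inequality, the chessboard fields -/
section Derive

variable {Ω ι Λ : Type*} [MeasurableSpace Ω] {d N : ℕ} [NeZero N] {P : Finset Λ} {T : ℕ → Finset ι}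
  {A : ℕ → ℝ → ι → ℝ} {Bad : ℕ → Finset ι} {μ : ℕ → Measure Ω} {Z : ℕ → ℝ} {ev : ℕ → ι → Set Ω}
  {obs : ℕ → Ω → ℝ} {ob : ℝ} {E : ℕ → Λ → BlockIdx d N → Set Ω} {θ : ℕ → Fin d → ZMod N → Ω → Ω}
  {mP : ℕ → Fin d → ZMod N → MeasurableSpace Ω} {r : ℕ → ℝ} {K₀ : ℕ}

/-- The exponential source factor is bounded two-sidedly: `e^{−ob|t|} ≤ e^{t·obs} ≤ e^{ob|t|}`. [folklore] -/
theorem exp_source_bounds {o t ob : ℝ} (ho : |o| ≤ ob) :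
    Real.exp (-(ob * |t|)) ≤ Real.exp (t * o) ∧ Real.exp (t * o) ≤ Real.exp (ob * |t|) := by
  have h1 : |t * o| ≤ ob * |t| := by
    rw [abs_mul, mul_comm]; exact mul_le_mul_of_nonneg_right ho (abs_nonneg t)
  have h2 := neg_abs_le (t * o); have h3 := le_abs_self (t * o)
  exact ⟨Real.exp_le_exp.2 (by linarith), Real.exp_le_exp.2 (by linarith)⟩

/-- The source-dressed mass of an event is sandwiched by its undressed mass:
`e^{−ob|t|}·μ(ev) ≤ ∫_{ev} e^{t·obs} dμ ≤ e^{ob|t|}·μ(ev)`. [folklore] -/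
theorem setIntegral_exp_bounds (ν : Measure Ω) [IsFiniteMeasure ν] {o : Ω → ℝ} (hom : Measurable o)
    (hob : ∀ ω, |o ω| ≤ ob) {s : Set Ω} (hs : MeasurableSet s) (t : ℝ) :
    Real.exp (-(ob * |t|)) * ν.real s ≤ ∫ ω in s, Real.exp (t * o ω) ∂ν ∧
      ∫ ω in s, Real.exp (t * o ω) ∂ν ≤ Real.exp (ob * |t|) * ν.real s := by
  have hmeas : Measurable fun ω => Real.exp (t * o ω) := (measurable_const.mul hom).exp
  have hint : Integrable (fun ω => Real.exp (t * o ω)) ν :=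
    Integrable.of_bound hmeas.aestronglyMeasurable (Real.exp (ob * |t|))
      (ae_of_all _ fun ω => by
        rw [Real.norm_eq_abs, abs_of_pos (Real.exp_pos _)]
        exact (exp_source_bounds (hob ω)).2)
  constructor
  · have h := setIntegral_mono_on (integrable_const (Real.exp (-(ob * |t|)))).integrableOn hint.integrableOn hs
      (fun ω _ => (exp_source_bounds (t := t) (hob ω)).1)
    rwa [setIntegral_const, smul_eq_mul, mul_comm] at h
  · have h := setIntegral_mono_on hint.integrableOn (integrable_const (Real.exp (ob * |t|))).integrableOn hs
      (fun ω _ => (exp_source_bounds (t := t) (hob ω)).2)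
    rwa [setIntegral_const, smul_eq_mul, mul_comm] at h

/-- **THE UNDRESSED WEIGHT IS THE MASS OF THE EVENT**: `A K 0 τ = Z K · μ_K(ev K τ)`. [folklore] -/
theorem EventReading.weight_zero_eq (H : EventReading d N P T A Bad μ Z ev obs ob E θ mP r K₀) {K : ℕ}
    (hK : K₀ ≤ K) {τ : ι} (hτ : τ ∈ T K) : A K 0 τ = Z K * (μ K).real (ev K τ) := by
  rw [H.repr K hK 0 τ hτ]
  simp only [zero_mul, Real.exp_zero, setIntegral_const, smul_eq_mul, mul_one]

/-- Undressed weights are nonnegative. [folklore] -/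
theorem EventReading.weight_zero_nonneg (H : EventReading d N P T A Bad μ Z ev obs ob E θ mP r K₀) {K : ℕ}
    (hK : K₀ ≤ K) {τ : ι} (hτ : τ ∈ T K) : 0 ≤ A K 0 τ := by
  rw [H.weight_zero_eq hK hτ]
  exact mul_nonneg (H.Z_pos K hK).le measureReal_nonneg

/-- **(DRESS) DERIVED**: the two-sided dressing of every term against its own `t = 0` value with the `|t|`-linear
exponent `ob·|t|` — hence, on the source window `|t| ≤ l₀`, W1's two inequalities with `m = ob·l₀`
(`HistoryChessboardDressing.dressing_of_linear`). [folklore] -/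
theorem EventReading.dressing (H : EventReading d N P T A Bad μ Z ev obs ob E θ mP r K₀) {l₀ : ℝ} :
    ∀ K t, |t| ≤ l₀ → K₀ ≤ K → ∀ τ ∈ T K,
      Real.exp (-(ob * l₀)) * A K 0 τ ≤ A K t τ ∧ A K t τ ≤ Real.exp (ob * l₀) * A K 0 τ := by
  intro K t ht hK τ hτ
  haveI := H.prob K hK
  have hZ := (H.Z_pos K hK).le
  have hlin : ∀ t' : ℝ, Real.exp (-(ob * |t'|)) * A K 0 τ ≤ A K t' τ ∧ A K t' τ ≤ Real.exp (ob * |t'|) * A K 0 τ := by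
    intro t'
    have hb := setIntegral_exp_bounds (μ K) (H.obs_meas K hK) (H.obs_bdd K hK) (H.ev_meas K hK τ hτ) t'
    rw [H.repr K hK t' τ hτ, H.weight_zero_eq hK hτ]
    constructor
    · calc Real.exp (-(ob * |t'|)) * (Z K * (μ K).real (ev K τ))
          = Z K * (Real.exp (-(ob * |t'|)) * (μ K).real (ev K τ)) := by ring
        _ ≤ Z K * ∫ ω in ev K τ, Real.exp (t' * obs K ω) ∂μ K := mul_le_mul_of_nonneg_left hb.1 hZ
    · calc Z K * ∫ ω in ev K τ, Real.exp (t' * obs K ω) ∂μ K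
          ≤ Z K * (Real.exp (ob * |t'|) * (μ K).real (ev K τ)) := mul_le_mul_of_nonneg_left hb.2 hZ
        _ = Real.exp (ob * |t'|) * (Z K * (μ K).real (ev K τ)) := by ring
  exact HistoryChessboardDressing.dressing_of_linear (A := fun t' => A K t' τ) (H.weight_zero_nonneg hK hτ)
    H.ob_nonneg hlin ht

/-- **(EXT)∘(LOC) DERIVED, probability currency**: the bad events' total probability is at most the total single-cell
probability over patterns and cells (disjoint additivity, inclusion, two union bounds). [folklore] -/
theorem EventReading.sum_bad_le_cells (H : EventReading d N P T A Bad μ Z ev obs ob E θ mP r K₀) {K : ℕ}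
    (hK : K₀ ≤ K) :
    ∑ τ ∈ Bad K, (μ K).real (ev K τ) ≤ ∑ l ∈ P, ∑ c : BlockIdx d N, (μ K).real (E K l c) := by
  haveI := H.prob K hK
  have hBT := H.bad_subset K hK
  have hU : ⋃ τ ∈ Bad K, ev K τ ⊆ ⋃ l ∈ P, ⋃ c ∈ (Finset.univ : Finset (BlockIdx d N)), E K l c := by
    intro ω hω
    obtain ⟨τ, hτ, hωτ⟩ := Set.mem_iUnion₂.1 hω
    have h := H.bad_sub K hK τ hτ hωτ
    simp only [Set.mem_iUnion, Finset.mem_univ, Set.iUnion_true] at h ⊢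
    exact h
  calc ∑ τ ∈ Bad K, (μ K).real (ev K τ) = (μ K).real (⋃ τ ∈ Bad K, ev K τ) :=
        (measureReal_biUnion_finset (H.bad_disj K hK) (fun τ hτ => H.ev_meas K hK τ (hBT hτ))).symm
    _ ≤ (μ K).real (⋃ l ∈ P, ⋃ c ∈ (Finset.univ : Finset (BlockIdx d N)), E K l c) :=
        measureReal_mono hU (measure_ne_top _ _)
    _ ≤ ∑ l ∈ P, (μ K).real (⋃ c ∈ (Finset.univ : Finset (BlockIdx d N)), E K l c) :=
        measureReal_biUnion_finset_le P _
    _ ≤ ∑ l ∈ P, ∑ c : BlockIdx d N, (μ K).real (E K l c) :=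
        sum_le_sum fun l _ => measureReal_biUnion_finset_le _ _

/-- The term events' total probability is at least one (they exhaust the probability state). [folklore] -/
theorem EventReading.one_le_sum_ev (H : EventReading d N P T A Bad μ Z ev obs ob E θ mP r K₀) {K : ℕ}
    (hK : K₀ ≤ K) : 1 ≤ ∑ τ ∈ T K, (μ K).real (ev K τ) := by
  haveI := H.prob K hK
  calc (1 : ℝ) = (μ K).real Set.univ := probReal_univ.symm
    _ ≤ (μ K).real (⋃ τ ∈ T K, ev K τ) := measureReal_mono (H.ev_cover K hK) (measure_ne_top _ _)
    _ ≤ ∑ τ ∈ T K, (μ K).real (ev K τ) := measureReal_biUnion_finset_le _ _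

/-- **THE `cover` FIELD OF FILE 1, DERIVED** (mass currency): `Σ_{Bad K} A K 0 ≤ (Σ_l Σ_c μ_K(E K l c))·Σ_{T K} A K 0`.
[folklore] -/
theorem EventReading.cover (H : EventReading d N P T A Bad μ Z ev obs ob E θ mP r K₀) {K : ℕ} (hK : K₀ ≤ K) :
    ∑ τ ∈ Bad K, A K 0 τ ≤
      (∑ l ∈ P, ∑ c : BlockIdx d N, (μ K).real (⋂ c' ∈ ({c} : Finset (BlockIdx d N)), E K l c')) *
        ∑ τ ∈ T K, A K 0 τ := by
  have hBT := H.bad_subset K hK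
  have hZ := H.Z_pos K hK
  simp only [Finset.set_biInter_singleton]
  have eBad : ∑ τ ∈ Bad K, A K 0 τ = Z K * ∑ τ ∈ Bad K, (μ K).real (ev K τ) := by
    rw [mul_sum]; exact sum_congr rfl fun τ hτ => H.weight_zero_eq hK (hBT hτ)
  have eT : ∑ τ ∈ T K, A K 0 τ = Z K * ∑ τ ∈ T K, (μ K).real (ev K τ) := by
    rw [mul_sum]; exact sum_congr rfl fun τ hτ => H.weight_zero_eq hK hτ
  rw [eBad, eT]
  have hX : 0 ≤ ∑ l ∈ P, ∑ c : BlockIdx d N, (μ K).real (E K l c) :=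
    sum_nonneg fun l _ => sum_nonneg fun c _ => measureReal_nonneg
  calc Z K * ∑ τ ∈ Bad K, (μ K).real (ev K τ) ≤ Z K * ∑ l ∈ P, ∑ c : BlockIdx d N, (μ K).real (E K l c) :=
        mul_le_mul_of_nonneg_left (H.sum_bad_le_cells hK) hZ.le
    _ = (∑ l ∈ P, ∑ c : BlockIdx d N, (μ K).real (E K l c)) * (Z K * 1) := by ring
    _ ≤ (∑ l ∈ P, ∑ c : BlockIdx d N, (μ K).real (E K l c)) * (Z K * ∑ τ ∈ T K, (μ K).real (ev K τ)) :=
        mul_le_mul_of_nonneg_left (mul_le_mul_of_nonneg_left (H.one_le_sum_ev hK) hZ.le) hX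

omit [NeZero N] in
/-- **THE CELL-PATTERN FUNCTIONAL IS AN EXPECTATION OF A PRODUCT OF INDICATORS**:
`μ(⋂_{c∈S} E c) = ∫ ∏_{c∈S} 𝟙_{E c} dμ`. [folklore] -/
theorem measureReal_biInter_eq_integral_prod_indicator (ν : Measure Ω) {F : BlockIdx d N → Set Ω}
    (hF : ∀ c, MeasurableSet (F c)) (S : Finset (BlockIdx d N)) :
    ν.real (⋂ c ∈ S, F c) = ∫ ω, ∏ c ∈ S, (F c).indicator (1 : Ω → ℝ) ω ∂ν := by
  have hprod : (fun ω => ∏ c ∈ S, (F c).indicator (1 : Ω → ℝ) ω) = (⋂ c ∈ S, F c).indicator 1 := by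
    funext ω
    rw [prod_indicator_apply, Finset.prod_const_one]
  rw [hprod, integral_indicator_one (Finset.measurableSet_biInter S fun c _ => hF c)]

omit [MeasurableSpace Ω] [NeZero N] in
/-- The indicator of a reflection-related cell event, composed with the reflection, is the indicator of the reflected
cell's event. [folklore] -/
theorem indicator_comp_of_preimage_eq {ϑ : Ω → Ω} {F : BlockIdx d N → Set Ω} {i : Fin d} {k : ZMod N}
    (h : ∀ c, ϑ ⁻¹' F c = F (cellReflect i k c)) (c : BlockIdx d N) (ω : Ω) :
    (F c).indicator (1 : Ω → ℝ) (ϑ ω) = (F (cellReflect i k c)).indicator (1 : Ω → ℝ) ω := by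
  rw [← h c]
  by_cases hω : ϑ ω ∈ F c
  · rw [Set.indicator_of_mem hω, Set.indicator_of_mem (show ω ∈ ϑ ⁻¹' F c from hω)]
    rfl
  · rw [Set.indicator_of_notMem hω, Set.indicator_of_notMem (show ω ∉ ϑ ⁻¹' F c from hω)]

/-- **FILE 1's READING, DERIVED**: the event reading gives the run's `ChessboardReading` for `a K τ := A K 0 τ` and
`ψ K l S := μ_K(⋂_{c∈S} E K l c)` — `cover` by §2, the chessboard fields by row W5's
`chessboardFields_of_isReflectionPositiveBdd` at `b c := 𝟙_{E K l c}` (via `loc`, `sym`), `univ_le` verbatim. [folklore] -/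
theorem EventReading.chessboardReading (H : EventReading d N P T A Bad μ Z ev obs ob E θ mP r K₀) (hN : Even N) :
    ChessboardReading d N P T (fun K => A K 0) Bad
      (fun K l S => (μ K).real (⋂ c ∈ S, E K l c)) r K₀ where
  bad_subset := H.bad_subset
  nonneg K hK τ hτ := H.weight_zero_nonneg hK hτ
  cover K hK := H.cover hK
  psi_nonneg K hK l _ S := measureReal_nonneg
  psi_empty K hK l _ := by
    haveI := H.prob K hK
    simp
  cs K hK l hl i k S := by
    haveI := H.prob K hK
    have hfields := HistoryChessboardRP.chessboardFields_of_isReflectionPositiveBdd (μ := μ K) (mP K)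
      (H.mP_le K hK) (θ K) (H.θ_meas K hK) (H.θ_pres K hK) (H.θ_invol K hK) (H.rp K hK) hN
      (fun c => (E K l c).indicator (1 : Ω → ℝ))
      (fun i k c hc => (@measurable_const ℝ Ω _ (mP K i k) 1).indicator (H.loc K hK l hl i k c hc))
      (fun c ω => Set.indicator_nonneg (fun _ _ => zero_le_one) ω)
      (fun c ω => Set.indicator_apply_le' (fun _ => le_rfl) (fun _ => zero_le_one))
      (fun i k c ω => indicator_comp_of_preimage_eq (H.sym K hK l hl i k) c ω)
      (fun S => (μ K).real (⋂ c ∈ S, E K l c))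
      (fun S => measureReal_biInter_eq_integral_prod_indicator (μ K) (H.E_meas K hK l hl) S)
    exact hfields.2.2 i k S
  univ_le := H.univ_le
  r_nonneg := H.r_nonneg

end Derive

/-! ## §3 The END: `HybridNE7` from the two runs' event readings -/
section End

variable {Ω Ω' ι Λ : Type*} [MeasurableSpace Ω] [MeasurableSpace Ω'] [DecidableEq ι] {d N : ℕ} [NeZero N]
  {P : Finset Λ} {T : ℕ → Finset ι} {K₀ : ℕ} {l₀ vol ob : ℝ} {A B shA shB Cc Rr CcRec RrRec : ℕ → ℝ → ι → ℝ}
  {Bad : ℕ → Finset ι} {μ : ℕ → Measure Ω} {μ' : ℕ → Measure Ω'} {Z Z' : ℕ → ℝ} {ev : ℕ → ι → Set Ω}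
  {ev' : ℕ → ι → Set Ω'} {obs : ℕ → Ω → ℝ} {obs' : ℕ → Ω' → ℝ} {E : ℕ → Λ → BlockIdx d N → Set Ω}
  {E' : ℕ → Λ → BlockIdx d N → Set Ω'} {θ : ℕ → Fin d → ZMod N → Ω → Ω} {θ' : ℕ → Fin d → ZMod N → Ω' → Ω'}
  {mP : ℕ → Fin d → ZMod N → MeasurableSpace Ω} {mP' : ℕ → Fin d → ZMod N → MeasurableSpace Ω'}
  {r r' ν u s₂ c₀ rr s Wsh : ℕ → ℝ}

/-- **THE ROAD'S END FROM THE EVENT READINGS** (node U5, seam (ζ′)): the two runs' event readings (own carriers, SAME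
source bound `ob` — take the larger —, patterns, bad classes, threshold; rates `r`, `r′`), `Even N`, summable rates, the
NE7c socket, the NE7 budget on the hybrid cores and four summable rates give `HybridNE7` for the families shifted by
`K₁ + K₂` with weight `e^{2·ob·l₀}·#P·N^d·(r + r′)` — file 1's `hybridNE7_of_chessboard`, its chessboard readings and
dressing binders DISCHARGED by §2.  Nothing PRINTED is asserted; NE7b is NOT proved by this. [folklore] -/
theorem hybridNE7_of_events (hN : Even N)
    (HA : EventReading d N P T A Bad μ Z ev obs ob E θ mP r K₀)
    (HB : EventReading d N P T B Bad μ' Z' ev' obs' ob E' θ' mP' r' K₀)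
    (hr : Summable r) (hr' : Summable r')
    (hSh : ShellWeightBound l₀ T A B shA shB Wsh)
    (hTB : ReindexedBudget l₀ vol T (fun K t τ => A K t τ - shA K t τ) (fun K t τ => B K t τ - shB K t τ)
      (fun K _ => Bad K) Cc Rr CcRec RrRec ν u s₂ c₀ rr s)
    (hrr : Summable rr) (hu : Summable u) (hs : Summable s) (hs₂ : Summable s₂) :
    ∃ K₁ K₂, K₀ ≤ K₁ ∧ HybridNE7 l₀ vol (fun K => T (K₁ + (K₂ + K))) (fun K => A (K₁ + (K₂ + K)))
      (fun K => B (K₁ + (K₂ + K))) (fun K _ => Bad (K₁ + (K₂ + K)))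
      (fun K => Real.exp (2 * (ob * l₀)) * ((#P : ℝ) * (N : ℝ) ^ d * (r (K₁ + (K₂ + K)) + r' (K₁ + (K₂ + K)))))
      (fun K => shA (K₁ + (K₂ + K))) (fun K => shB (K₁ + (K₂ + K))) (fun K => Wsh (K₁ + (K₂ + K)))
      (fun K => (rr (K₁ + (K₂ + K)) + u (K₁ + (K₂ + K))) + (s (K₁ + (K₂ + K)) + s₂ (K₁ + (K₂ + K)))) :=
  hybridNE7_of_chessboard hN (HA.chessboardReading hN) (HB.chessboardReading hN) hr hr' HA.dressing HB.dressing hSh hTB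
    hrr hu hs hs₂

end End

/-! ## §4 Sanity: the event reading is inhabited -/

namespace Sanity

/-- NON-VACUITY: the event reading is INHABITED — carrier `Unit`, Dirac state, `Z = 1`, terms `{true, false}` with
events `univ`∕`∅`, bad class `{false}`, all cell events `univ`, source `0`, identity reflections, `mP = ⊥`, rate `1`. -/
example : EventReading 1 2 ({()} : Finset Unit) (fun _ => ({true, false} : Finset Bool))
    (fun _ _ b => if b then (1 : ℝ) else 0) (fun _ => {false}) (fun _ => Measure.dirac ())
    (fun _ => 1) (fun _ b => if b then Set.univ else ∅) (fun _ _ => 0) 0 (fun _ _ _ => Set.univ)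
    (fun _ _ _ => id) (fun _ _ _ => ⊥) (fun _ => 1) 0 where
  prob _ _ := Measure.dirac.isProbabilityMeasure
  Z_pos _ _ := one_pos
  bad_subset _ _ := by simp
  ev_meas _ _ τ _ := by cases τ <;> simp
  E_meas _ _ _ _ _ := MeasurableSet.univ
  obs_meas _ _ := measurable_const
  obs_bdd _ _ _ := by simp
  ob_nonneg := le_rfl
  repr _ _ t τ _ := by
    cases τ
    · simp
    · simp [Measure.restrict_univ]
  ev_cover _ _ := by
    intro ω _
    simp only [Set.mem_iUnion, Finset.mem_insert, Finset.mem_singleton]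
    exact ⟨true, Or.inl rfl, Set.mem_univ _⟩
  bad_disj _ _ := by simp
  bad_sub _ _ τ hτ := by
    simp only [Finset.mem_singleton] at hτ
    subst hτ
    simp
  mP_le _ _ _ _ := bot_le
  θ_meas _ _ _ _ := measurable_id
  θ_pres _ _ _ _ := MeasurePreserving.id _
  θ_invol _ _ _ _ := rfl
  rp _ _ _ _ := by
    intro g _ _
    exact integral_nonneg fun ω => mul_self_nonneg (g ω)
  loc _ _ _ _ _ _ _ _ := by simp
  sym _ _ _ _ _ _ _ := by simp
  univ_le _ _ _ _ := (measureReal_mono (Set.subset_univ _) (measure_ne_top _ _)).trans_eq (by simp)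
  r_nonneg _ _ := zero_le_one

end Sanity

end

end Summit.QuantumFields.BalabanUV.T4Continuum.HistoryChessboardEvents
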